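import Literature.AlgebraicGeometry.Deligne1982.WeilTypeCMSignature
import Literature.AlgebraicGeometry.Deligne1982.HyperbolicOfSplitDiscriminantCMKaehler
import Literature.AlgebraicGeometry.Deligne1982.WeilTypeCMFieldIsCM
import Summits.HodgeConjecture.HodgeConjecture.Theorems.Ring2HypothesesWeilComponentsCMRosati
import HarnessLib

/-!
# Ring 2 — Weil-type family-coverage census, CM-field rows (X-D): the SIGN of the discriminant class of a POLARIZED
# Weil-type CM datum — Deligne 1982 §4 (1) `sign_τ disc φ = (-1)^{b_τ}` on the carriers; wrong-sign rows are EMPTY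

HONEST FRAMING: research route conditional on HC_CM; not a corollary; Q11.4-sentence-2 already refuted in dim ≥ 3.

Cell `pub-hodge-ring2`, seat `ring2-b03` (gen 55), census `WEIL-FAMILY-COVERAGE.md` «## b03» (CM fields `[E:ℚ] > 2`),
rows `W8.E.δ` («δ totally positive», b03.2) and b03.8 (`g = 12`: «δ totally negative»). THEOREMS ONLY: no `def`, no
named fact, no `sorry`; nothing here is a case of the Hodge conjecture, `HC_CM` does not occur. Independent of parts
X-A/X-B/X-C; valid for a CM field `E = ℚ[T]/(R(T²))` of ANY degree (no Galois hypothesis).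

Deligne, LNM 900 §4 p. 30 (1): «`sign(τ disc φ) = (-1)^{b_τ}` for every real embedding `τ` of `F`», with (4.5):
«of Weil type … `a_σ = b_σ = d/2`». The hypotheses layer records (`Ring2HypothesesWeilComponentsCM`, honest column):
«EMPTY / SIGN CONSTRAINTS (`sign(τ f) = (-1)^{b_τ}`, Deligne (1)) are not known to the carriers and not used». This file
PROVES the sign constraint on the carriers, in the tree's normalisation of the discriminant class
(`HasWeilDiscriminantCM`: `δ = [q]`, `ι q = t^{2k} det Φ`, `Φ` the Gram matrix of `φ₁ = t φ`):

* §1 `re_ringHom_norm_pos`, `im_ringHom_realToCM`, `re_ringHom_realToCM_ne_zero`, `sign_re_ringHom_of_mk_eq_mk` — at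
  every complex embedding `τ` of `E`, elements of `ι F` are real, norms `z z̄` are positive reals, and two
  representatives of one class of `F^×/Nm_{E/F}(E^×)` have the same sign (the sign of a class at a real place is
  well defined — stated representative-wise, no new definition).
* §2 **`re_pos_of_hasWeilDiscriminantCM_of_hodgeRiemann`** — Deligne's (1) in the Weil case: for `IsWeilTypeCM A η R e₀ k`,
  a rational class `h` Rosati-compatible with `η` satisfying Hodge–Riemann in degree one (format of
  `Deligne1982.exists_orthogonalBasis_card_pos_eq`), and `HasWeilDiscriminantCM A η R e₀ k h δ`: EVERY representative
  `q` of `δ` has `(-1)^k τ(ι q) > 0` at EVERY embedding `τ` — the class `δ` has the sign `(-1)^k` at every real place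
  of `F`. Proof: Landherr's orthogonal basis with exactly `k` positive entries at each `τ` (tree theorem (4.5),
  `exists_orthogonalBasis_card_pos_eq`, fed by Hodge–Riemann), the diagonal entries are real (the Hermitian matrix
  `H₀ = t⁻¹Φᵀ`), `∏ dᵢ = Nm(det G) · t^{-4k} · ι q`, and `τ(t)` is purely imaginary.
* §3 corollaries: `…_of_isKaehlerMultiple` (Hodge–Riemann from a Kähler multiple,
  `hodgeRiemann_degreeOne_of_isKaehlerClass_smul`), `…_hyperplane` (from `hodgeRiemann_degreeOne_of_isOfHodgeType`);
  **`not_hasWeilDiscriminantCM_of_sign_ne`** — a class with the WRONG sign at one real place is the discriminant of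
  NO Kähler-polarized Weil-type CM datum: the wrong-sign rows of the census are EMPTY for polarized members
  (for `k = 2`, `g = 8`: every polarized member has TOTALLY POSITIVE `δ`; for `k = 3`: totally negative).

HONEST COLUMN: the cells `WeilClassesComponentCM R e₀ k δ` quantify over `IsPolarizationClass` (no positivity) and
ARE inhabited for every `δ` (part X-A); the sign constraint bites only for classes with a Kähler multiple / a
Hodge–Riemann form, which is what a polarization in Deligne's sense is. The converse (every right-sign class carries
a Kähler-polarized CM member) is NOT proved here.

## References
* [Deligne1982HodgeCycles] P. Deligne (notes by J. S. Milne), LNM 900 (1982), §4 p. 30 (1), Prop. 4.1, Cor. 4.2,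
  (4.5) pp. 32–33, Lemma 4.6.
* [Landherr1936HermitianForms] W. Landherr, Abh. Math. Sem. Hamburg 11 (1936).
* [VoisinHodgeI2002] C. Voisin, *Hodge Theory and Complex Algebraic Geometry I* (2002), Thm. 6.32 (Hodge–Riemann).
-/

noncomputable section

set_option linter.dupNamespace false

namespace Summit.HodgeConjecture.HodgeConjecture.Ring2.WeilCoverageCM

open CategoryTheory Polynomial
open scoped Matrix ComplexConjugate
open Literature.AlgebraicTopology.SingularHomology
open Literature.AlgebraicGeometry Literature.AlgebraicGeometry.Motives Literature.AlgebraicGeometry.HodgeTheory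
open Literature.AlgebraicGeometry.Deligne1982
open Literature.AlgebraicGeometry.VanGeemen1994 (pullbackOne)
open Summit.HodgeConjecture.HodgeConjecture.Ring2.Hypotheses (RosatiCompatible IsKaehlerMultiple)

variable {R : Polynomial ℤ}

/-! ## §1 Signs at the complex embeddings: `ι F` is real, norms are positive, the sign of a class is well defined -/

/-- `τ(ι a)` is REAL for every `a ∈ F` and every embedding `τ : E → ℂ` (`ι a` is fixed by `e ↦ ē` and
`τ(ē) = conj τ(e)`). [cite: Deligne1982HodgeCycles, §4 p. 30] -/
theorem im_ringHom_realToCM (hR : ∀ s : ℂ, Polynomial.eval₂ (Int.castRingHom ℂ) s R = 0 → s.im = 0 ∧ s.re < 0)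
    (τ : cmField R →+* ℂ) (a : realField R) : (τ (realToCM R a)).im = 0 := by
  have h : conj (τ (realToCM R a)) = τ (realToCM R a) := by rw [← ringHom_cmConj hR, cmConj_realToCM]
  exact Complex.conj_eq_iff_im.1 h

/-- `τ(ι q) ≠ 0`, hence `Re τ(ι q) ≠ 0`, for a unit `q ∈ F^×`. [cite: Deligne1982HodgeCycles, §4 p. 30] -/
theorem re_ringHom_realToCM_ne_zero [Fact (Irreducible (cmPolyQ R))] [Fact (Irreducible (realPolyQ R))]
    (hR : ∀ s : ℂ, Polynomial.eval₂ (Int.castRingHom ℂ) s R = 0 → s.im = 0 ∧ s.re < 0)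
    (τ : cmField R →+* ℂ) (q : (realField R)ˣ) : (τ (realToCM R (q : realField R))).re ≠ 0 := by
  intro h0
  have hz : τ (realToCM R (q : realField R)) = 0 :=
    Complex.ext (by rw [h0, Complex.zero_re]) (by rw [im_ringHom_realToCM hR, Complex.zero_im])
  have hz' : realToCM R (q : realField R) = 0 := τ.injective (by rw [hz, map_zero])
  exact q.ne_zero ((realToCM R).injective (by rw [hz', map_zero]))

/-- **Norms are totally positive**: `τ(z z̄) = |τ z|²` is a positive real for `z ≠ 0`. [cite: Deligne1982HodgeCycles, §4 p. 30] -/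
theorem ringHom_mul_cmConj_eq (hR : ∀ s : ℂ, Polynomial.eval₂ (Int.castRingHom ℂ) s R = 0 → s.im = 0 ∧ s.re < 0)
    (τ : cmField R →+* ℂ) (z : cmField R) : τ (z * cmConj R z) = ((Complex.normSq (τ z) : ℝ) : ℂ) := by
  rw [map_mul, ringHom_cmConj hR, Complex.mul_conj]

/-- `Re τ(z z̄) > 0` and `Im τ(z z̄) = 0` for `z ≠ 0`. [cite: Deligne1982HodgeCycles, §4 p. 30] -/
theorem re_ringHom_norm_pos [Fact (Irreducible (cmPolyQ R))]
    (hR : ∀ s : ℂ, Polynomial.eval₂ (Int.castRingHom ℂ) s R = 0 → s.im = 0 ∧ s.re < 0)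
    (τ : cmField R →+* ℂ) {z : cmField R} (hz : z ≠ 0) :
    0 < (τ (z * cmConj R z)).re ∧ (τ (z * cmConj R z)).im = 0 := by
  rw [ringHom_mul_cmConj_eq hR, Complex.ofReal_re, Complex.ofReal_im]
  refine ⟨Complex.normSq_pos.2 fun h0 => hz (τ.injective (by rw [h0, map_zero])), rfl⟩

/-- **The sign of a class at a real place is well defined**: two representatives `q, q'` of one class of
`F^×/Nm_{E/F}(E^×)` have `Re τ(ι q) · Re τ(ι q') > 0` at every embedding `τ` (they differ by a norm `z z̄`, a positive
real under `τ`). [cite: Deligne1982HodgeCycles, §4 p. 30 («independent … up to … Nm_{E/F} E^×»)] -/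
theorem sign_re_ringHom_of_mk_eq_mk [Fact (Irreducible (cmPolyQ R))] [Fact (Irreducible (realPolyQ R))]
    (hR : ∀ s : ℂ, Polynomial.eval₂ (Int.castRingHom ℂ) s R = 0 → s.im = 0 ∧ s.re < 0)
    {q q' : (realField R)ˣ} (h : (QuotientGroup.mk q : cmNormResidueGroup R) = QuotientGroup.mk q')
    (τ : cmField R →+* ℂ) :
    0 < (τ (realToCM R (q : realField R))).re * (τ (realToCM R (q' : realField R))).re := by
  obtain ⟨z, hz0, hz⟩ := exists_mul_cmConj_of_mk_eq_mk h
  rw [algebraMap_realField_eq] at hz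
  obtain ⟨hpos, him⟩ := re_ringHom_norm_pos hR τ hz0
  have hre : (τ (realToCM R (q' : realField R))).re =
      (τ (realToCM R (q : realField R))).re * (τ (z * cmConj R z)).re := by
    rw [hz, map_mul, Complex.mul_re, him, mul_zero, sub_zero]
  rw [hre, ← mul_assoc]
  exact mul_pos (mul_self_pos.2 (re_ringHom_realToCM_ne_zero hR τ q)) hpos

/-! ## §2 Deligne's (1): the discriminant class of a Hodge–Riemann-polarized Weil-type datum has sign `(-1)^k` everywhere -/

/-- Sign count: if exactly `k` of `2k` non-zero reals are positive, their product has the sign `(-1)^k`. [folklore] -/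
private theorem neg_one_pow_mul_prod_pos {k : ℕ} (r : Fin (2 * k) → ℝ) (hr : ∀ i, r i ≠ 0)
    (hpos : (Finset.univ.filter fun i => 0 < r i).card = k) : 0 < (-1 : ℝ) ^ k * ∏ i, r i := by
  classical
  have hsplit := Finset.prod_filter_mul_prod_filter_not Finset.univ (fun i => 0 < r i) r
  have hcard' : (Finset.univ.filter fun i : Fin (2 * k) => ¬ 0 < r i).card = k := by
    have h := Finset.card_filter_add_card_filter_not (s := (Finset.univ : Finset (Fin (2 * k))))
      (fun i : Fin (2 * k) => 0 < r i)
    rw [hpos, Finset.card_univ, Fintype.card_fin] at h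
    omega
  have h1 : 0 < ∏ i ∈ Finset.univ.filter (fun i => 0 < r i), r i :=
    Finset.prod_pos fun i hi => (Finset.mem_filter.1 hi).2
  have h5 : ∏ _i ∈ Finset.univ.filter (fun i => ¬ 0 < r i), (-1 : ℝ) = (-1 : ℝ) ^ k := by
    rw [Finset.prod_const, hcard']
  have h2 : ∏ i ∈ Finset.univ.filter (fun i => ¬ 0 < r i), r i =
      (-1 : ℝ) ^ k * ∏ i ∈ Finset.univ.filter (fun i => ¬ 0 < r i), (-r i) := by
    rw [← h5, ← Finset.prod_mul_distrib]
    exact Finset.prod_congr rfl fun i _ => by ring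
  have h3 : 0 < ∏ i ∈ Finset.univ.filter (fun i => ¬ 0 < r i), (-r i) :=
    Finset.prod_pos fun i hi => by
      have hle : ¬ 0 < r i := (Finset.mem_filter.1 hi).2
      rcases lt_trichotomy (r i) 0 with hlt | heq | hgt
      · exact neg_pos.2 hlt
      · exact absurd heq (hr i)
      · exact absurd hgt hle
  have h4 : (-1 : ℝ) ^ k * (-1 : ℝ) ^ k = 1 := by
    rw [← pow_add, ← two_mul, pow_mul]; norm_num
  rw [← hsplit, h2, show (-1 : ℝ) ^ k * ((∏ i ∈ Finset.univ.filter (fun i => 0 < r i), r i) *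
      ((-1 : ℝ) ^ k * ∏ i ∈ Finset.univ.filter (fun i => ¬ 0 < r i), -r i)) =
    ((-1 : ℝ) ^ k * (-1 : ℝ) ^ k) * ((∏ i ∈ Finset.univ.filter (fun i => 0 < r i), r i) *
      ∏ i ∈ Finset.univ.filter (fun i => ¬ 0 < r i), -r i) by ring, h4, one_mul]
  exact mul_pos h1 h3

section Sign

variable {A : AbelianVariety ℂ} {η : A ⟶ A} {e₀ k : ℕ}

/-- The diagonal of `ᵗḠ H₀ G` is fixed by `e ↦ ē` when `H₀` is Hermitian (`ᵗH̄₀ = H₀`). [folklore] -/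
private theorem cmConj_diag_eq {n : Type} [Fintype n] [DecidableEq n] {G H₀ : Matrix n n (cmField R)}
    {d : n → cmField R} (hH : H₀.transpose.map (cmConj R) = H₀)
    (hdiag : (G.transpose.map (cmConj R)) * H₀ * G = Matrix.diagonal d) (i : n) : cmConj R (d i) = d i := by
  have hσσ : ∀ M : Matrix n n (cmField R), (M.map (cmConj R)).map (cmConj R) = M := fun M => by
    ext a b; simp only [Matrix.map_apply, cmConj_cmConj]
  have h1 : ((G.transpose.map (cmConj R)) * H₀ * G).transpose.map (cmConj R) =
      (G.transpose.map (cmConj R)) * H₀ * G := by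
    rw [Matrix.transpose_mul, Matrix.transpose_mul, Matrix.map_mul, Matrix.map_mul, ← Matrix.transpose_map,
      Matrix.transpose_transpose, hσσ, hH, Matrix.mul_assoc]
  rw [hdiag, Matrix.diagonal_transpose, Matrix.diagonal_map (map_zero _)] at h1
  exact congrFun (Matrix.diagonal_injective h1) i

/-- **Deligne 1982 §4 (1) on the carriers, Weil case: `sign_τ(disc φ) = (-1)^{b_τ} = (-1)^k` at EVERY real place.**
For a Weil-type CM datum `IsWeilTypeCM A η R e₀ k`, a rational class `h` whose Rosati involution is complex conjugation
on `E` and which satisfies Hodge–Riemann in degree one (format of `exists_orthogonalBasis_card_pos_eq`: `i Q_h(z, z̄)`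
is a positive multiple of a fixed rational top class on `H^{1,0} ∖ 0`), and a discriminant `HasWeilDiscriminantCM A η R
e₀ k h δ`: every representative `q ∈ F^×` of `δ` satisfies `(-1)^k · Re τ(ι q) > 0` at every embedding `τ : E → ℂ`
(`τ(ι q)` is real, §1). Proof: Landherr's orthogonal basis `ᵗḠ H₀ G = diag(d)`, `H₀ = t⁻¹Φᵀ`, with exactly `k` of the
(real) `τ(dᵢ)` positive and the other `k` negative (tree theorem (4.5) `exists_orthogonalBasis_card_pos_eq`, from
Hodge–Riemann); `∏ᵢ dᵢ · t^{4k} = Nm(det G) · ι q₀` with `τ(Nm det G) > 0` and `τ(t)^{4k} > 0` (`τ(t)` purely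
imaginary); representatives of one class share their signs (§1).
[cite: Deligne1982HodgeCycles, §4 p. 30 (1), (4.5) pp. 32–33, Lemma 4.6] [cite: Landherr1936HermitianForms] -/
theorem re_pos_of_hasWeilDiscriminantCM_of_hodgeRiemann [Fact (Irreducible (realPolyQ R))]
    (hW : IsWeilTypeCM A η R e₀ k) {h : complexBetti A.X 2} (hQ : IsRationalClass h) (hros : RosatiCompatible A η h)
    (hHR : ∃ ω₀ : complexBetti A.X (2 + 2 * (A.dim - 1)), IsRationalClass ω₀ ∧ ω₀ ≠ 0 ∧
      ∀ z : complexBetti A.X 1, IsOfHodgeType (A.dim - 1 + 1) A.X 1 1 0 z → z ≠ 0 →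
        ∃ t : ℝ, 0 < t ∧ Complex.I • polarizationPairingOne A.X h (A.dim - 1) z (conjClass (ComplexPoints A.X) 1 z) =
          (t : ℂ) • ω₀)
    {δ : cmNormResidueGroup R} (hδ : HasWeilDiscriminantCM A η R e₀ k h δ)
    {q : (realField R)ˣ} (hq : (QuotientGroup.mk q : cmNormResidueGroup R) = δ) (τ : cmField R →+* ℂ) :
    0 < (-1 : ℝ) ^ k * (τ (realToCM R (q : realField R))).re := by
  classical
  haveI : Fact (Irreducible (cmPolyQ R)) := hW.fact_irreducible_cmPolyQ
  have hR := hW.root_real_neg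
  have hdeg2 : 2 ≤ (cmPolyQ R).natDegree := by rw [hW.natDegree_cmPolyQ]; have := hW.e₀_pos; omega
  have ht0 : cmRoot R ≠ 0 := cmRoot_ne_zero R hdeg2
  obtain ⟨x, ω, c, Φ, q₀, hx, hind, hω, hω0, hQx, htr, hdet, hq₀⟩ := hδ
  -- `det Φ ≠ 0`
  have hΦ0 : Φ.det ≠ 0 := by
    intro h0
    have h1 : algebraMap (realField R) (cmField R) (q₀ : realField R) = 0 := by rw [hdet, h0, mul_zero]
    exact q₀.ne_zero ((map_eq_zero _).1 h1)
  -- Landherr's orthogonal basis with `k` positive entries at every embedding ((4.5), from Hodge–Riemann)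
  obtain ⟨G, d, hG, hdiag, hcount⟩ := exists_orthogonalBasis_card_pos_eq hW hQ hros hHR hx hω hω0 hQx htr hΦ0
  -- `H₀ = t⁻¹ Φᵀ` is Hermitian, so the `dᵢ` are real
  have hskew : ∀ a b, cmConj R (Φ a b) = -Φ b a := fun a b => cmConj_gram_eq_neg_swap hW hros hω0 hQx htr a b
  have hσtinv : cmConj R (cmRoot R)⁻¹ = -(cmRoot R)⁻¹ := by
    rw [map_inv₀, cmConj_cmRoot]
    field_simp
  have hH₀herm : ((cmRoot R)⁻¹ • Φ.transpose).transpose.map (cmConj R) = (cmRoot R)⁻¹ • Φ.transpose := by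
    ext a b
    simp only [Matrix.map_apply, Matrix.transpose_apply, Matrix.smul_apply, smul_eq_mul, map_mul, hσtinv, hskew]
    ring
  have hdreal : ∀ i, cmConj R (d i) = d i := cmConj_diag_eq hH₀herm hdiag
  set r : Fin (2 * k) → ℝ := fun i => (τ (d i)).re with hrdef
  have hdi : ∀ i, τ (d i) = (r i : ℂ) := fun i => by
    have h1 : conj (τ (d i)) = τ (d i) := by rw [← ringHom_cmConj hR, hdreal]
    exact Complex.ext (by simp [hrdef]) (by rw [Complex.ofReal_im]; exact Complex.conj_eq_iff_im.1 h1)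
  -- determinant of `ᵗḠ H₀ G = diag d`: `∏ dᵢ = σ(det G) · det G · t^{-2k} · det Φ`
  have hprod : ∏ i, d i = cmConj R G.det * G.det * ((cmRoot R ^ (2 * k))⁻¹ * Φ.det) := by
    have h1 := congrArg Matrix.det hdiag
    rw [Matrix.det_diagonal, Matrix.det_mul, Matrix.det_mul, Matrix.det_smul, Matrix.det_transpose,
      Fintype.card_fin, inv_pow] at h1
    have h2 : (G.transpose.map (cmConj R)).det = cmConj R G.det := by
      rw [← AlgHom.mapMatrix_apply, ← AlgHom.map_det, Matrix.det_transpose]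
    rw [← h1, h2]
    ring
  -- `t^{2k} det Φ = ι q₀`, so `(∏ dᵢ) · t^{2k} · t^{2k} = (det G · σ det G) · ι q₀`
  have hprod' : (∏ i, d i) * (cmRoot R) ^ (2 * k) * (cmRoot R) ^ (2 * k) =
      (G.det * cmConj R G.det) * realToCM R (q₀ : realField R) := by
    have hc : (cmRoot R ^ (2 * k))⁻¹ * cmRoot R ^ (2 * k) = 1 := inv_mul_cancel₀ (pow_ne_zero _ ht0)
    rw [← algebraMap_realField_eq, hdet, hprod]
    linear_combination (cmConj R G.det * G.det * Φ.det * cmRoot R ^ (2 * k)) * hc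
  -- apply `τ`
  obtain ⟨hNpos, hNim⟩ := re_ringHom_norm_pos hR τ hG.ne_zero
  set N : ℝ := (τ (G.det * cmConj R G.det)).re with hNdef
  have hN : τ (G.det * cmConj R G.det) = (N : ℂ) := Complex.ext (by simp [hNdef]) (by rw [hNim, Complex.ofReal_im])
  set Q : ℝ := (τ (realToCM R (q₀ : realField R))).re with hQdef
  have hQc : τ (realToCM R (q₀ : realField R)) = (Q : ℂ) :=
    Complex.ext (by simp [hQdef]) (by rw [im_ringHom_realToCM hR, Complex.ofReal_im])
  have hQ0 : Q ≠ 0 := re_ringHom_realToCM_ne_zero hR τ q₀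
  -- `τ(t)^{2k} τ(t)^{2k} = ((Im τ t)²)^{2k} > 0`
  set y : ℝ := (τ (cmRoot R)).im with hydef
  have hτt : τ (cmRoot R) = (y : ℂ) * Complex.I :=
    Complex.ext (by simp [hydef, re_ringHom_cmRoot hR τ]) (by simp [hydef])
  have hy0 : y ≠ 0 := by
    intro h0
    exact ringHom_cmRoot_ne_zero hR τ (by rw [hτt, h0, Complex.ofReal_zero, zero_mul])
  set Y : ℝ := (y ^ 2) ^ (2 * k) with hYdef
  have hY : τ (cmRoot R) ^ (2 * k) * τ (cmRoot R) ^ (2 * k) = (Y : ℂ) := by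
    rw [← pow_add, show 2 * k + 2 * k = 2 * (2 * k) by ring, pow_mul, hτt, mul_pow, Complex.I_sq, mul_neg, mul_one,
      Even.neg_pow (even_two_mul k), hYdef, Complex.ofReal_pow, Complex.ofReal_pow]
  have hy2 : 0 < y ^ 2 := lt_of_le_of_ne (sq_nonneg y) (Ne.symm (pow_ne_zero 2 hy0))
  have hYpos : 0 < Y := pow_pos hy2 _
  -- the real identity `(∏ rᵢ) · Y = N · Q`
  have hreal : (∏ i, r i) * Y = N * Q := by
    have h1 := congrArg τ hprod'
    rw [map_mul, map_mul, map_mul, map_prod, map_pow, mul_assoc, hY, hN, hQc] at h1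
    simp_rw [hdi] at h1
    exact_mod_cast h1
  -- signs: `rᵢ ≠ 0`, `#{rᵢ > 0} = k`
  have hYpos' : 0 < Y := hYpos
  have hr0 : ∀ i, r i ≠ 0 := by
    have hP : (∏ i, r i) ≠ 0 := by
      intro h0
      have : N * Q = 0 := by rw [← hreal, h0, zero_mul]
      exact mul_ne_zero hNpos.ne' hQ0 this
    exact fun i => (Finset.prod_ne_zero_iff.1 hP) i (Finset.mem_univ i)
  have hsign := neg_one_pow_mul_prod_pos r hr0 (hcount τ)
  -- conclude for `q₀`, then for `q`
  have hq₀pos : 0 < (-1 : ℝ) ^ k * Q := by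
    have h1 : 0 < N * ((-1 : ℝ) ^ k * Q) := by
      rw [show N * ((-1 : ℝ) ^ k * Q) = (-1 : ℝ) ^ k * (N * Q) by ring, ← hreal,
        show (-1 : ℝ) ^ k * ((∏ i, r i) * Y) = ((-1 : ℝ) ^ k * ∏ i, r i) * Y by ring]
      exact mul_pos hsign hYpos
    exact (mul_pos_iff_of_pos_left hNpos).1 h1
  have hqq : 0 < Q * (τ (realToCM R (q : realField R))).re :=
    sign_re_ringHom_of_mk_eq_mk hR (hq₀.trans hq.symm) τ
  have h2 : 0 < ((-1 : ℝ) ^ k * Q) * (Q * (τ (realToCM R (q : realField R))).re) := mul_pos hq₀pos hqq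
  rw [show ((-1 : ℝ) ^ k * Q) * (Q * (τ (realToCM R (q : realField R))).re) =
      (Q * Q) * ((-1 : ℝ) ^ k * (τ (realToCM R (q : realField R))).re) by ring] at h2
  exact (mul_pos_iff_of_pos_left (mul_self_pos.2 hQ0)).1 h2

/-- **The same for a class with a KÄHLER multiple** (a polarization in Deligne's sense; Hodge–Riemann in degree one
is the tree's `hodgeRiemann_degreeOne_of_isKaehlerClass_smul`): the discriminant class of a Kähler-polarized Weil-type
CM datum has the sign `(-1)^k` at every real place of `F`. [cite: Deligne1982HodgeCycles, §4 p. 30 (1) and (4.5)]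
[cite: VoisinHodgeI2002, Thm. 6.32] -/
theorem re_pos_of_hasWeilDiscriminantCM_of_isKaehlerMultiple [Fact (Irreducible (realPolyQ R))]
    (hW : IsWeilTypeCM A η R e₀ k) {h : complexBetti A.X 2} (hQ : IsRationalClass h) (hros : RosatiCompatible A η h)
    (hK : IsKaehlerMultiple A h) {δ : cmNormResidueGroup R} (hδ : HasWeilDiscriminantCM A η R e₀ k h δ)
    {q : (realField R)ˣ} (hq : (QuotientGroup.mk q : cmNormResidueGroup R) = δ) (τ : cmField R →+* ℂ) :
    0 < (-1 : ℝ) ^ k * (τ (realToCM R (q : realField R))).re := by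
  have h2 := hW.two_le_dim
  have hA : A.dim = A.dim - 1 + 1 := by omega
  have hK' : ∃ s : ℝ, s ≠ 0 ∧ IsKaehlerClass (A.dim - 1 + 1) A.X ((s : ℂ) • h) := by rw [← hA]; exact hK
  exact re_pos_of_hasWeilDiscriminantCM_of_hodgeRiemann hW hQ hros
    (hodgeRiemann_degreeOne_of_isKaehlerClass_smul (by omega) (Motives.isSmoothProjective_of_dim_eq' hA) hQ hK') hδ hq τ

/-- **The same for a HYPERPLANE class `h = e^*a`** (`a ≠ 0` rational; Hodge–Riemann is the tree's
`hodgeRiemann_degreeOne_of_isOfHodgeType`). [cite: Deligne1982HodgeCycles, §4 p. 30 (1) and (4.5)] [cite: VoisinHodgeI2002, Thm. 6.32] -/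
theorem re_pos_of_hasWeilDiscriminantCM_hyperplane [Fact (Irreducible (realPolyQ R))]
    (hW : IsWeilTypeCM A η R e₀ k) (e : Motives.ProjectiveEmbedding A.X)
    {a : complexBetti (Motives.projectiveSpace e.n ℂ) 2} (ha : IsRationalClass a) (ha0 : a ≠ 0)
    (hros : RosatiCompatible A η (complexBetti.map e.ι 2 a)) {δ : cmNormResidueGroup R}
    (hδ : HasWeilDiscriminantCM A η R e₀ k (complexBetti.map e.ι 2 a) δ)
    {q : (realField R)ˣ} (hq : (QuotientGroup.mk q : cmNormResidueGroup R) = δ) (τ : cmField R →+* ℂ) :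
    0 < (-1 : ℝ) ^ k * (τ (realToCM R (q : realField R))).re := by
  have hA : A.dim = A.dim - 1 + 1 := by have := hW.two_le_dim; omega
  exact re_pos_of_hasWeilDiscriminantCM_of_hodgeRiemann hW (ha.map _) hros
    (hodgeRiemann_degreeOne_of_isOfHodgeType (Motives.isSmoothProjective_of_dim_eq' hA) e ha ha0) hδ hq τ

end Sign

/-! ## §3 EMPTY rows: a class of the wrong sign is the discriminant of no Kähler-polarized Weil-type CM datum -/

section Empty

variable [Fact (Irreducible (realPolyQ R))] {e₀ k : ℕ}

/-- **Wrong-sign rows are EMPTY for polarized members.** If a class `[q] ∈ F^×/Nm_{E/F}(E^×)` has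
`(-1)^k · Re τ(ι q) < 0` at SOME embedding `τ` (the wrong sign at one real place of `F`), then NO Weil-type CM datum
`(A, η)` of `E`-rank `2k` carries a rational, Rosati-compatible class with a Kähler multiple and discriminant `[q]`:
the component `(E, 2k, [q])` has no polarized member (Deligne (1): e.g. for `k = 2`, `g = 8`, every polarized member
has TOTALLY POSITIVE `δ`; for `k = 3`, `g = 12`, totally negative). [cite: Deligne1982HodgeCycles, §4 p. 30 (1) and (4.5)] -/
theorem not_exists_kaehler_member_of_sign_lt {q : (realField R)ˣ} {τ : cmField R →+* ℂ}
    (hτ : (-1 : ℝ) ^ k * (τ (realToCM R (q : realField R))).re < 0) :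
    ¬ ∃ (A : AbelianVariety ℂ) (η : A ⟶ A) (h : complexBetti A.X 2), IsWeilTypeCM A η R e₀ k ∧ IsRationalClass h ∧
      RosatiCompatible A η h ∧ IsKaehlerMultiple A h ∧
      HasWeilDiscriminantCM A η R e₀ k h (QuotientGroup.mk q : cmNormResidueGroup R) := by
  rintro ⟨A, η, h, hW, hQ, hros, hK, hδ⟩
  exact absurd (re_pos_of_hasWeilDiscriminantCM_of_isKaehlerMultiple hW hQ hros hK hδ rfl τ) (not_lt.2 hτ.le)

/-- **`g = 8` rows (`k = 2`): every Kähler-polarized member of a row `W8.E.δ` has `δ` TOTALLY POSITIVE** —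
`Re τ(ι q) > 0` at every embedding for every representative `q` (census b03.2: «δ totally positive»).
[cite: Deligne1982HodgeCycles, §4 p. 30 (1)] -/
theorem re_pos_of_kaehler_member_two {A : AbelianVariety ℂ} {η : A ⟶ A} (hW : IsWeilTypeCM A η R e₀ 2)
    {h : complexBetti A.X 2} (hQ : IsRationalClass h) (hros : RosatiCompatible A η h) (hK : IsKaehlerMultiple A h)
    {δ : cmNormResidueGroup R} (hδ : HasWeilDiscriminantCM A η R e₀ 2 h δ)
    {q : (realField R)ˣ} (hq : (QuotientGroup.mk q : cmNormResidueGroup R) = δ) (τ : cmField R →+* ℂ) :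
    0 < (τ (realToCM R (q : realField R))).re := by
  have h1 := re_pos_of_hasWeilDiscriminantCM_of_isKaehlerMultiple hW hQ hros hK hδ hq τ
  norm_num at h1
  exact h1

/-- **`g = 12` rows with `E` quartic (`k = 3`): every Kähler-polarized member has `δ` TOTALLY NEGATIVE** (census
b03.8). [cite: Deligne1982HodgeCycles, §4 p. 30 (1)] -/
theorem re_neg_of_kaehler_member_three {A : AbelianVariety ℂ} {η : A ⟶ A} (hW : IsWeilTypeCM A η R e₀ 3)
    {h : complexBetti A.X 2} (hQ : IsRationalClass h) (hros : RosatiCompatible A η h) (hK : IsKaehlerMultiple A h)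
    {δ : cmNormResidueGroup R} (hδ : HasWeilDiscriminantCM A η R e₀ 3 h δ)
    {q : (realField R)ˣ} (hq : (QuotientGroup.mk q : cmNormResidueGroup R) = δ) (τ : cmField R →+* ℂ) :
    (τ (realToCM R (q : realField R))).re < 0 := by
  have h1 := re_pos_of_hasWeilDiscriminantCM_of_isKaehlerMultiple hW hQ hros hK hδ hq τ
  norm_num at h1
  linarith

end Empty

end Summit.HodgeConjecture.HodgeConjecture.Ring2.WeilCoverageCM

end
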